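import Summits.BirchSwinnertonDyer.BirchSwinnertonDyer.Theorems.ManinLocalTwoThreeSameLevelTwistTransport
import Summits.BirchSwinnertonDyer.BirchSwinnertonDyer.Theorems.ManinLocalTwoThreeManinOddOfReducibleOfCuspidalKummer
import Summits.BirchSwinnertonDyer.Rank1Residual.ManinAdditive.CuspidalKummerCubeLaws
import HarnessLib
import HarnessLib.Audit.Tags


/-!
# The `3`-part of the Manin constant along same-level coprime quadratic twists (E-an-91 / E-an-91′ / E-an-93)

Summit `BirchSwinnertonDyer`, route `ManinLocalTwoThree` (cell bsd-f2-manin), crux C3 `ManinPrimeToThreeAtNine`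
(stmt-BirchSwinnertonDyer-22968), line `kato_shift_three` (v8 of record), stub 5 `NoRationalThreeTorsionOrbitMinimalResidual`
(RES₃′).  Source: the cell's analytic seat, gen 20 (MEMO-an §62, HOME/an/Sketch-an-g20.lean §§1–3, A-an-19 «transport, not
port»); landed by the C3 lead (ask T-an-26, theorems half).  All three results are PROVED; nothing about BSD or Manin's
conjecture is asserted — E-an-93 is a conditional fold whose hypothesis `hTors` is supplied BY NAME from the `p = 3`
cuspidal-Kummer cube programme (E-an-57 ∧ LAW₃ ∧ E-an-58, all open).

* §1 E-an-91 `maninConstant_dvd_mul_of_twist_pStar_descaled` — `c(D) ∣ q·c(D')` up a DESCALED `χ_{q*}`-twist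
  (`q¹² Δ(C) = (q*)⁶ Δ(A)`), any levels `N' ∣ N`; twin of the landed aligned clause
  `maninLocalTwoThree_maninConstant_dvd_of_twist_pStar_aligned` (which gives `c(D) ∣ c(D')`).
* §2 E-an-91′ `not_three_dvd_maninConstant_of_untwist_pStar_coprime` — `q` prime, `q ∉ {2, 3}`, either alignment:
  `3 ∤ c(D') ⟹ 3 ∤ c(D)` (the factor `q` is invisible to `ord₃`).
* §3 E-an-93 `not_three_dvd_maninConstant_of_coprimeTwistPartner_shortThreeTorsion` — if every lattice-optimal datum of
  `9 ∣` level with a rational short-model `3`-torsion point has `3 ∤ c`, then so does every `W` with a same-`3`-level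
  coprime twist partner carrying such a point; `…_of_shortThreeTorsion_forall` supplies that hypothesis from
  `CuspidalKummerCubeRepresentativeAtNine ∧ CuspidalKummerCubeExponentLaw ∧ ManinPrimeToThreeOfEtaExponent`.

Census behind the fold (HOME/an/g20/, `N ≤ 5000`): of the 23 orbit-minimal optimal classes with `9 ∣ N`, a non-rational
cuspidal `3`-point and no rational one, 13 have a same-level `q*`-partner (`q ≥ 5`) whose optimal curve carries a RATIONAL
cuspidal `3`-point (225a1←225b1, 441a1←441b1, …, 4761b1←4761a1; 8 descaled + 5 aligned — both clauses are needed).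

References: [Stevens1989] Lemmas (5.2), (5.4); [Pal2012] Prop. 2.5, Lemma 3.1; [SilvermanATAEC1994] Cor. IV.9.1.
-/

set_option autoImplicit false
set_option linter.dupNamespace false

noncomputable section

open scoped MatrixGroups ModularForm Classical NumberField

namespace Summit.BirchSwinnertonDyer.BirchSwinnertonDyer.Theorems

open PowerSeries CongruenceSubgroup WeierstrassCurve IsDedekindDomain IsDedekindDomain.HeightOneSpectrum
  Rat.HeightOneSpectrum Literature.NumberTheory.Automorphic
  Literature.NumberTheory.EllipticCurves Literature.NumberTheory.EllipticCurves.ModularForms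
  Summit.BirchSwinnertonDyer.Rank1Residual.ManinAdditive
  Summit.BirchSwinnertonDyer.Rank1Residual.ManinAdditive.CuspidalKummer
  Summit.BirchSwinnertonDyer.Rank1Residual.ManinAdditive.CuspidalKummerThree

/-! ## §1 E-an-91: `c(D) ∣ q · c(D')` up a DESCALED `χ_{q*}`-twist, generic levels -/

/-- **E-an-91 (PROVED).  `c(D) ∣ q · c(D')` along a DESCALED `χ_{q*}`-twist** (`q` an odd prime). `W` globally minimal
with a lattice-optimal `X₀(N)`-datum `D`, additive at `q`, `q² ∣ N`; `A` any elliptic curve with ANY `X₀(N')`-datum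
`D'`, `N' ∣ N`; `C = u • (A ⊗ ℚ(√q*))` globally minimal, isogenous to `W`, with `q¹² Δ(C) = (q*)⁶ Δ(A)` (DESCALED,
`ũ = q`).  Then `c(D) ∣ q · c(D')`.  Clause 2 of the cell's THEOREM A (`twistOrbitManinTransport_pStar`) with the
conductor-level bookkeeping removed, exactly as p2 did for clause 1: `f_D = f_{D'} ⊗ χ_q`, `Λ_C ⊇ q g(χ_q)⁻¹ Λ_A`
(`neronLattice_mem_iff_of_twist_pStar`, `r = q`), factor-`r` chain `maninConstant_dvd_mul_of_charTwist_gamma0`.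
[cite: Stevens1989, Lemmas (5.2), (5.4)] [cite: Pal2012, Lemma 3.1] [cite: SilvermanATAEC1994, Cor. IV.9.1] -/
theorem maninConstant_dvd_mul_of_twist_pStar_descaled
    {q : ℕ} [Fact q.Prime] (hq2 : q ≠ 2)
    {W : WeierstrassCurve ℚ} [W.IsElliptic] [W.IsGloballyMinimal] {N : ℕ} [NeZero N]
    (D : ModularParametrizationData W N)
    (hopt : ∀ z ∈ D.L.lattice, ∃ w ∈ periodLattice D.f, z = D.c * w)
    {A : WeierstrassCurve ℚ} [A.IsElliptic] {N' : ℕ} [NeZero N'] (D' : ModularParametrizationData A N')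
    (hN'N : N' ∣ N) (hqN : q ^ 2 ∣ N)
    (hadd : ¬ W.HasGoodReductionAtPrime q ∧ ¬ W.HasMultiplicativeReductionAtPrime q)
    {C : WeierstrassCurve ℚ} [C.IsElliptic] [C.IsGloballyMinimal] (u : VariableChange ℚ)
    (hu : u • A.quadraticTwist (((-1 : ℤ) ^ (q / 2) * q : ℤ) : ℚ) = C) (hCW : IsIsogenous C W)
    (hΔ : (q : ℚ) ^ 12 * C.Δ = ((((-1 : ℤ) ^ (q / 2) * q : ℤ)) : ℚ) ^ 6 * A.Δ) :
    D.c ∣ (q : ℤ) * D'.c := by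
  have hq : q.Prime := Fact.out
  haveI : NeZero q := ⟨hq.ne_zero⟩
  have hW0 : ∀ n : ℕ, q ∣ n → W.LFunction n = 0 := fun n hn ↦
    W.LFunction_apply_eq_zero_of_not_good_of_not_mult q hadd.1 hadd.2 hn
  -- `aₙ(f_D) = χ_q(n) aₙ(f_{D'})`
  have hcoef : ∀ n : ℕ, cuspCoeff D.f n =
      (quadraticChar (ZMod q)).ringHomComp (Int.castRingHom ℂ) n * cuspCoeff D'.f n := fun n ↦
    cuspCoeff_eq_chi_mul_of_twist_pStar hq2 u hu (LFunction_eq_of_isIsogenous_holds _ _ hCW) hW0 D' D n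
  -- `Λ_C ⊇ q g(χ_q)⁻¹ Λ_A`
  obtain ⟨LC, hLC⟩ := exists_isNeronLatticeOf_holds (C.baseChange ℂ)
  have hq0 : (q : ℂ) ≠ 0 := by exact_mod_cast hq.ne_zero
  have hmem : ∀ z : ℂ,
      gaussSum ((quadraticChar (ZMod q)).ringHomComp (Int.castRingHom ℂ)) (ZMod.stdAddChar (N := q)) * z ∈
        D'.L.lattice → (((q : ℤ) : ℂ)) * z ∈ LC.lattice := by
    intro z hz
    rw [neronLattice_mem_iff_of_twist_pStar hq2 u hu hΔ D'.isNeronLattice hLC]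
    convert hz using 2
    push_cast
    rw [← mul_assoc, inv_mul_cancel₀ hq0, one_mul]
  have hqN' : q ^ 2 ∣ N := hqN
  exact maninConstant_dvd_mul_of_charTwist_gamma0 D' D hopt (isQuadratic_quadraticChar_ringHomComp q)
    (isPrimitive_quadraticChar_ringHomComp q hq2) hN'N hqN' hcoef hLC (q : ℤ) hmem

/-! ## §2 E-an-91′: the `3`-part is invariant along a same-level `χ_{q*}`-twist, `q ∉ {2, 3}`, either alignment -/

/-- **E-an-91′ (PROVED).  Transport of `3 ∤ c` UP a `χ_{q*}`-twist of EITHER alignment, `q` prime, `q ≠ 2, 3`.**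
In the situation of §1 / of p2's aligned clause, with Pal's dichotomy for the pair as a hypothesis
(`Δ(C) = (q*)⁶ Δ(A)` or `q¹² Δ(C) = (q*)⁶ Δ(A)`): `3 ∤ c(D') ⟹ 3 ∤ c(D)` (`c(D) ∣ c(D')` resp. `c(D) ∣ q c(D')`, and
`3 ∤ q`).  This is the «lossless in `ord₃`» transport INTO an orbit-minimal member (A-an-19).
[cite: Stevens1989, Lemmas (5.2), (5.4)] [cite: Pal2012, Prop. 2.5, Lemma 3.1] -/
theorem not_three_dvd_maninConstant_of_untwist_pStar_coprime
    {q : ℕ} [Fact q.Prime] (hq2 : q ≠ 2) (hq3 : q ≠ 3)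
    {W : WeierstrassCurve ℚ} [W.IsElliptic] [W.IsGloballyMinimal] {N : ℕ} [NeZero N]
    (D : ModularParametrizationData W N)
    (hopt : ∀ z ∈ D.L.lattice, ∃ w ∈ periodLattice D.f, z = D.c * w)
    {A : WeierstrassCurve ℚ} [A.IsElliptic] {N' : ℕ} [NeZero N'] (D' : ModularParametrizationData A N')
    (hN'N : N' ∣ N) (hqN : q ^ 2 ∣ N)
    (hadd : ¬ W.HasGoodReductionAtPrime q ∧ ¬ W.HasMultiplicativeReductionAtPrime q)
    {C : WeierstrassCurve ℚ} [C.IsElliptic] [C.IsGloballyMinimal] (u : VariableChange ℚ)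
    (hu : u • A.quadraticTwist (((-1 : ℤ) ^ (q / 2) * q : ℤ) : ℚ) = C) (hCW : IsIsogenous C W)
    (hΔ : C.Δ = ((((-1 : ℤ) ^ (q / 2) * q : ℤ)) : ℚ) ^ 6 * A.Δ ∨
      (q : ℚ) ^ 12 * C.Δ = ((((-1 : ℤ) ^ (q / 2) * q : ℤ)) : ℚ) ^ 6 * A.Δ)
    (hp : ¬ (3 : ℤ) ∣ D'.c) : ¬ (3 : ℤ) ∣ D.c := by
  have hq : q.Prime := Fact.out
  rcases hΔ with hΔ | hΔ
  · exact maninLocalTwoThree_not_dvd_maninConstant_of_untwist_pStar_aligned hq2 D hopt D' hN'N hqN hadd u hu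
      hCW hΔ hp
  · intro h3
    have hdq : D.c ∣ (q : ℤ) * D'.c :=
      maninConstant_dvd_mul_of_twist_pStar_descaled hq2 D hopt D' hN'N hqN hadd u hu hCW hΔ
    have h3q : (3 : ℤ) ∣ (q : ℤ) * D'.c := h3.trans hdq
    rcases Int.prime_three.dvd_mul.mp h3q with h | h
    · have h' : (3 : ℕ) ∣ q := by exact_mod_cast h
      exact hq3 ((Nat.prime_dvd_prime_iff_eq Nat.prime_three hq).mp h').symm
    · exact hp h

/-! ## §3 E-an-93: the FOLD — a coprime twist partner with a rational short `3`-torsion point certifies `3 ∤ c(W)` -/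

/-- **E-an-93 (PROVED).  The fold.**  Suppose every globally minimal curve with a lattice-optimal `X₀(M)`-datum,
`9 ∣ M`, and a rational point of order `3` on the short model has `3 ∤ c` (hypothesis `hTors`; ⟸ E-an-57 ∧ LAW₃ ∧
E-an-58 by `not_three_dvd_maninConstant_of_shortThreeTorsion`).  Let `W` (lattice-optimal datum `D` of level `N`) be
additive at a prime `q ∉ {2, 3}`, `q² ∣ N`, and let `A` be a same-`3`-level twist partner: globally minimal,
lattice-optimal datum `D'` of level `N' ∣ N` with `9 ∣ N'`, `C = u • (A ⊗ ℚ(√q*))` globally minimal and isogenous to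
`W`, of either alignment, and `A` has a rational short-model `3`-torsion point.  Then `3 ∤ c(D)`.  (The twisted line
of `W[3]` — rational over the real or imaginary quadratic field cut out by `χ_{q*}` — becomes RATIONAL on `A`; no port
of the cube law to that field is needed.) [cite: Stevens1989, Lemmas (5.2), (5.4)] [cite: Pal2012, Prop. 2.5] -/
theorem not_three_dvd_maninConstant_of_coprimeTwistPartner_shortThreeTorsion
    (hTors : ∀ (B : WeierstrassCurve ℚ) [B.IsElliptic] [B.IsGloballyMinimal] {M : ℕ} [NeZero M]
      (DB : ModularParametrizationData B M), 9 ∣ M →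
      (∀ z ∈ DB.L.lattice, ∃ w ∈ periodLattice DB.f, z = DB.c * w) →
      ∀ X₀ Y₀ : ℚ, IsShortThreeTorsion B DB.c X₀ Y₀ → ¬ (3 : ℤ) ∣ DB.c)
    {q : ℕ} [Fact q.Prime] (hq2 : q ≠ 2) (hq3 : q ≠ 3)
    {W : WeierstrassCurve ℚ} [W.IsElliptic] [W.IsGloballyMinimal] {N : ℕ} [NeZero N]
    (D : ModularParametrizationData W N)
    (hopt : ∀ z ∈ D.L.lattice, ∃ w ∈ periodLattice D.f, z = D.c * w)
    {A : WeierstrassCurve ℚ} [A.IsElliptic] [A.IsGloballyMinimal] {N' : ℕ} [NeZero N']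
    (D' : ModularParametrizationData A N') (hN'N : N' ∣ N) (h9' : 9 ∣ N') (hqN : q ^ 2 ∣ N)
    (hopt' : ∀ z ∈ D'.L.lattice, ∃ w ∈ periodLattice D'.f, z = D'.c * w)
    (hadd : ¬ W.HasGoodReductionAtPrime q ∧ ¬ W.HasMultiplicativeReductionAtPrime q)
    {C : WeierstrassCurve ℚ} [C.IsElliptic] [C.IsGloballyMinimal] (u : VariableChange ℚ)
    (hu : u • A.quadraticTwist (((-1 : ℤ) ^ (q / 2) * q : ℤ) : ℚ) = C) (hCW : IsIsogenous C W)
    (hΔ : C.Δ = ((((-1 : ℤ) ^ (q / 2) * q : ℤ)) : ℚ) ^ 6 * A.Δ ∨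
      (q : ℚ) ^ 12 * C.Δ = ((((-1 : ℤ) ^ (q / 2) * q : ℤ)) : ℚ) ^ 6 * A.Δ)
    {X₀ Y₀ : ℚ} (hT : IsShortThreeTorsion A D'.c X₀ Y₀) : ¬ (3 : ℤ) ∣ D.c :=
  not_three_dvd_maninConstant_of_untwist_pStar_coprime hq2 hq3 D hopt D' hN'N hqN hadd u hu hCW hΔ
    (hTors A D' h9' hopt' X₀ Y₀ hT)

/-- `hTors` of E-an-93 BY NAME from the `p = 3` cuspidal-Kummer cube programme: E-an-57 (`CuspidalKummerCubeRepresentativeAtNine`)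
∧ LAW₃ (`CuspidalKummerCubeExponentLaw`) ∧ E-an-58 (`ManinPrimeToThreeOfEtaExponent`, itself ⟸ E-an-55 by p3's
`maninPrimeToThreeOfEtaExponent_of_maninThreeKummerCube`).  (PROVED edge; `IsParamGerm` witnesses by `exists_isParamGerm`.) -/
theorem not_three_dvd_maninConstant_of_shortThreeTorsion_forall
    (h57 : CuspidalKummerCubeRepresentativeAtNine) (hLaw : CuspidalKummerCubeExponentLaw)
    (h58 : ManinPrimeToThreeOfEtaExponent) :
    ∀ (B : WeierstrassCurve ℚ) [B.IsElliptic] [B.IsGloballyMinimal] {M : ℕ} [NeZero M]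
      (DB : ModularParametrizationData B M), 9 ∣ M →
      (∀ z ∈ DB.L.lattice, ∃ w ∈ periodLattice DB.f, z = DB.c * w) →
      ∀ X₀ Y₀ : ℚ, IsShortThreeTorsion B DB.c X₀ Y₀ → ¬ (3 : ℤ) ∣ DB.c := by
  intro B _ _ M _ DB h9 hL X₀ Y₀ hT
  set a : ℕ → ℤ := fun n => B.LFunction n with ha_def
  have ha : ∀ n, (a n : ℂ) = cuspCoeff DB.f n := fun n => (DB.isNewformOf.2 n).symm
  obtain ⟨z, hz⟩ := ManinLocalTwoThree.exists_isParamGerm B DB.c a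
  exact not_three_dvd_maninConstant_of_shortThreeTorsion h57 hLaw h58 B DB a ha h9 hL hT hz


end Summit.BirchSwinnertonDyer.BirchSwinnertonDyer.Theorems

end
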